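import Literature.MathematicalPhysics.QuantumFieldTheory.Balaban1983to89.CentreTwist
import HarnessLib

/-!
# `Balaban1983to89.CentreTwistBlockAvg` — the centre twist INTERTWINES with Bałaban's block averaging (0.4): the twist of the
fine torus `T^{(j)}` along the hyperplane through the block centres of a coarse slice is carried by (0.4) to the twist of the
coarse torus `T^{(j+1)}` along that slice; iterated over the levels (bookkeeping; nothing open is asserted)

CITATION HEADER (lean-in-tree rule).  Cell `ym3-torus` (HUMAN RULING D-0037, rung R3), seat `ym3-torus-p2`; companion of `CentreTwist` (twist = exact
symmetry of every Wilson theory; winding law) toward `T3CentreSymmetry`.  Sources: T. Bałaban, CMP **109** (1987) [Balaban1987RG1] (0.4) p. 253 (the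
block averaging `Ū(c) = exp[i Σ … log U(Γ ∪ [x,x′] ∪ (−Γ′) ∪ (−c))] U(c)`: the correction factor is a function of holonomies of CLOSED CONTRACTIBLE
loops, the bond variable `U(c)` is the transport along the straight line of `L` fine bonds between block centres), (2.17) p. 269 («By their
definitions the expressions in (2.1) are invariant with respect to these transformations» — the same bookkeeping for the centre twist, which is
a symmetry of the torus gauge theory though not an isometry); G. 't Hooft, Nucl. Phys. B **153** (1979) [tHooft1979Flux] §2.

WHAT IS PROVED ([folklore] bookkeeping over `CentreTwist` and the tree's `BlockAveraging`): in the standing range `j + 1 ≤ m + K`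
(`N_j = L·N_{j+1}`), with `fineSlice s` = the `μ`-coordinate `L·s + (L−1)/2` of the centres of the blocks of the coarse slice `s`:
the (0.4) loop variables and the small-field guard are twist-invariant (`loopHol_ctwist`, `small_ctwist_iff`, `corr_ctwist` — closed
contractible loops, `CentreTwist.holAt_ctwist_walk_of_netDisp_eq_zero`); the straight line of a coarse `μ`-bond from `y` contains exactly
`[y_μ = s]` twisted fine bonds (`sliceFloor_line`, integer arithmetic), so `axialAvg (ctwist_{fineSlice s} U) c = z^{[c twisted]} axialAvg U c`;
hence **`avgFun ℰ (ctwist z μ (fineSlice s) U) = ctwist z μ s (avgFun ℰ U)`** for every small-loop average `ℰ` and central `z`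
(`avgFun_ctwist`), and by induction over the levels **every coarse twist at level `k ≤ m + K` is the image under the `k`-fold averaging of
SOME fine twist of `T^{(0)}`** (`exists_iter_blockAvg_ctwist`).
-/

noncomputable section

namespace Literature.MathematicalPhysics.QuantumFieldTheory.Balaban1983to89

namespace BlockAveraging

open T4Continuum AveragingRT GaugeField

variable {P : Params} {j : ℕ} {G : Type*} [GaugeGroup G] {z : G}

/-! ## 1. The fine slice under a coarse slice; the line arithmetic -/

/-- The `μ`-coordinate of the centres of the blocks of the coarse slice `s`: `L·s + (L−1)/2` (tree `Setup.emb`, centred blocks,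
[Balaban1987RG1] p. 251 «sites = centres of cubes»). [cite: Balaban1987RG1, (0.1) p.252] -/
def fineSlice (P : Params) (j : ℕ) (s : ZMod (P.sitesPerDir (j+1))) : ZMod (P.sitesPerDir j) :=
  ((s.val * P.L + (P.L - 1) / 2 : ℕ) : ZMod (P.sitesPerDir j))

/-- Block centres lie on the fine slices of their coarse coordinates: `(emb y)_μ = fineSlice (y_μ)`. [cite: Balaban1987RG1, (0.1) p.252] -/
theorem emb_apply_eq_fineSlice (y : Site P (j+1)) (μ : Fin P.d) : emb y μ = fineSlice P j (y μ) := rfl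

/-- In the standing range the defining natural number of `fineSlice s` is below the fine period, so it IS the value. [folklore] -/
private theorem fineSlice_val (hj : j + 1 ≤ P.m + P.K) (s : ZMod (P.sitesPerDir (j+1))) :
    (fineSlice P j s).val = s.val * P.L + (P.L - 1) / 2 := by
  rw [fineSlice, ZMod.val_natCast_of_lt]
  have hs := ZMod.val_lt s
  have hL := P.L_pos
  rw [P.sitesPerDir_eq_mul_succ hj]
  have h1 : s.val * P.L + P.L ≤ P.sitesPerDir (j+1) * P.L := by
    rw [← Nat.succ_mul]; exact Nat.mul_le_mul_right _ hs
  have h2 : (P.L - 1) / 2 < P.L := by omega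
  omega

/-- INTEGER ARITHMETIC OF THE LINE: for `|D| < N'`, `L ≥ 1`, `⌊(DL + L − 1)/(N'L)⌋ − ⌊(DL − 1)/(N'L)⌋ = [D = 0]` — among the `L`
consecutive integers `DL, …, DL + L − 1` exactly `[D = 0]` are multiples of `N'L`. [folklore] -/
private theorem ediv_line_window {N' L : ℤ} (hN' : 0 < N') (hL : 0 < L) {D : ℤ} (hD1 : -N' < D) (hD2 : D < N') :
    (D * L + L - 1) / (N' * L) - (D * L - 1) / (N' * L) = if D = 0 then 1 else 0 := by
  have hM : 0 < N' * L := mul_pos hN' hL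
  have hM0 : N' * L ≠ 0 := hM.ne'
  -- quotient of an integer in `[-M, 0)` is `-1`, in `[0, M)` is `0`
  have neg_one_of : ∀ a : ℤ, -(N' * L) ≤ a → a < 0 → a / (N' * L) = -1 := fun a h1 h2 => by
    have h3 : (a + N' * L) / (N' * L) = 0 := Int.ediv_eq_zero_of_lt (by linarith) (by linarith)
    have h4 := Int.add_mul_ediv_right (a + N' * L) (-1) hM0
    rw [show a + N' * L + -1 * (N' * L) = a by ring, h3] at h4
    linarith
  rcases lt_trichotomy D 0 with hD | hD | hD
  · rw [if_neg hD.ne]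
    have hDL : D * L ≤ -L := by nlinarith
    have hDL' : -(N' * L) + L ≤ D * L := by nlinarith
    rw [neg_one_of _ (by linarith) (by linarith), neg_one_of _ (by linarith) (by linarith), sub_self]
  · subst hD
    rw [if_pos rfl, zero_mul, zero_add, Int.ediv_eq_zero_of_lt (by linarith) (by nlinarith),
      neg_one_of _ (by linarith) (by linarith)]
    ring
  · rw [if_neg hD.ne']
    have hDL : L ≤ D * L := by nlinarith
    have hDL' : D * L + L ≤ N' * L := by nlinarith
    rw [Int.ediv_eq_zero_of_lt (by linarith) (by linarith), Int.ediv_eq_zero_of_lt (by linarith) (by linarith), sub_self]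

/-- **THE STRAIGHT LINE OF A COARSE `μ`-BOND CONTAINS EXACTLY `[y_μ = s]` FINE BONDS OF THE SLICE `fineSlice s`** (staircase form:
`F(a + L) − F(a) = [y_μ = s]` with `a` the integer label of the centre's `μ`-coordinate; `N_j = L N_{j+1}`; the straight contour of `L`
bonds between block centres of [Balaban1984PropagatorsI] (1.7), tree `AveragingRT.line`). [cite: Balaban1984PropagatorsI, (1.7) p.18] -/
theorem sliceFloor_line (hj : j + 1 ≤ P.m + P.K) (s : ZMod (P.sitesPerDir (j+1))) (y : Site P (j+1)) (μ : Fin P.d) :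
    sliceFloor (P.sitesPerDir j) (fineSlice P j s) (((y μ).val * P.L + (P.L - 1) / 2 : ℕ) + (P.L : ℤ)) -
        sliceFloor (P.sitesPerDir j) (fineSlice P j s) (((y μ).val * P.L + (P.L - 1) / 2 : ℕ) : ℤ) =
      if y μ = s then 1 else 0 := by
  have hN : (P.sitesPerDir j : ℤ) = (P.sitesPerDir (j+1) : ℤ) * P.L := by
    rw [P.sitesPerDir_eq_mul_succ hj]; push_cast; ring
  have hN' : (0 : ℤ) < P.sitesPerDir (j+1) := by exact_mod_cast Nat.pos_of_ne_zero (P.sitesPerDir_ne_zero (j+1))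
  have hL : (0 : ℤ) < P.L := by exact_mod_cast P.L_pos
  have hy := ZMod.val_lt (y μ)
  have hs := ZMod.val_lt s
  simp only [sliceFloor, fineSlice_val hj, hN, Nat.cast_add, Nat.cast_mul]
  set D : ℤ := ((y μ).val : ℤ) - (s.val : ℤ) with hD
  have e1 : ((y μ).val : ℤ) * P.L + ((P.L - 1) / 2 : ℕ) + P.L - 1 - ((s.val : ℤ) * P.L + ((P.L - 1) / 2 : ℕ)) = D * P.L + P.L - 1 := by
    rw [hD]; ring
  have e2 : ((y μ).val : ℤ) * P.L + ((P.L - 1) / 2 : ℕ) - 1 - ((s.val : ℤ) * P.L + ((P.L - 1) / 2 : ℕ)) = D * P.L - 1 := by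
    rw [hD]; ring
  rw [e1, e2, ediv_line_window hN' hL (by omega) (by omega)]
  have hiff : D = 0 ↔ y μ = s := by
    rw [hD, sub_eq_zero, Int.natCast_inj]
    exact (ZMod.val_injective _).eq_iff
  simp only [hiff]

/-! ## 2. One level: the (0.4) loop variables are twist-blind, the straight line picks up the coarse twist -/

/-- The (0.4) loop variables are holonomies of CLOSED CONTRACTIBLE loops, hence invariant under every central twist. [cite: Balaban1987RG1, (0.4) p.253] -/
theorem loopHol_ctwist (hz : ∀ g : G, z * g = g * z) (μ : Fin P.d) (s : ZMod (P.sitesPerDir j)) (U : GaugeField P j G)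
    (c : PBond P (j+1)) : loopHol (U.ctwist z μ s) c = loopHol U c := by
  funext i
  exact holAt_ctwist_walk_of_netDisp_eq_zero hz μ s U (emb c.src) (netDisp_loopWord P.L c.dir (off i.1) i.2.1 i.2.2 μ)

/-- … so the small-field guard is twist-invariant … [cite: Balaban1987RG1, (0.4) p.253] -/
theorem small_ctwist_iff (ℰ : LoopAverage G) (hz : ∀ g : G, z * g = g * z) (μ : Fin P.d) (s : ZMod (P.sitesPerDir j))
    (U : GaugeField P j G) (c : PBond P (j+1)) : Small ℰ (U.ctwist z μ s) c ↔ Small ℰ U c := by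
  simp only [Small, loopHol_ctwist hz]

/-- … and so is the correction factor of (0.4). [cite: Balaban1987RG1, (0.4) p.253] -/
theorem corr_ctwist (ℰ : LoopAverage G) (hz : ∀ g : G, z * g = g * z) (μ : Fin P.d) (s : ZMod (P.sitesPerDir j))
    (U : GaugeField P j G) (c : PBond P (j+1)) : corr ℰ (U.ctwist z μ s) c = corr ℰ U c := by
  classical
  simp only [corr, small_ctwist_iff ℰ hz, loopHol_ctwist hz]

/-- **THE COARSE BOND VARIABLE PICKS UP THE COARSE TWIST**: the straight-line transport of the fine configuration twisted along
`fineSlice s` is `z^{[c.dir = μ ∧ (c.src)_μ = s]}` times the untwisted one. [cite: Balaban1987RG1, (0.4) p.253] -/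
theorem axialAvg_ctwist (hj : j + 1 ≤ P.m + P.K) (hz : ∀ g : G, z * g = g * z) (μ : Fin P.d) (s : ZMod (P.sitesPerDir (j+1)))
    (U : GaugeField P j G) (c : PBond P (j+1)) :
    axialAvg (U.ctwist z μ (fineSlice P j s)) c = (if c.dir = μ ∧ c.src μ = s then z else 1) * axialAvg U c := by
  rw [axialAvg_eq_holAt_walk, axialAvg_eq_holAt_walk,
    holAt_ctwist_walk hz μ _ U _ (emb c.src) (((c.src μ).val * P.L + (P.L - 1) / 2 : ℕ) : ℤ) (by rw [Int.cast_natCast]; rfl),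
    twistExp_eq_sliceFloor, T4ReflectionCone.netDisp_replicate]
  by_cases hd : c.dir = μ
  · simp only [hd, if_true, mul_one, true_and]
    rw [sliceFloor_line hj s c.src μ]
    split_ifs <;> simp
  · simp only [hd, if_false, false_and, mul_zero, add_zero, sub_self, zpow_zero]

/-- **(0.4) INTERTWINES THE CENTRE TWISTS**: `avgFun ℰ (ctwist z μ (fineSlice s) U) = ctwist z μ s (avgFun ℰ U)` — every small-loop
average `ℰ`, every central `z`, standing range. [cite: Balaban1987RG1, (2.17) p.269] -/
theorem avgFun_ctwist (ℰ : LoopAverage G) (hj : j + 1 ≤ P.m + P.K) (hz : ∀ g : G, z * g = g * z) (μ : Fin P.d)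
    (s : ZMod (P.sitesPerDir (j+1))) (U : GaugeField P j G) :
    avgFun ℰ (U.ctwist z μ (fineSlice P j s)) = (avgFun ℰ U).ctwist z μ s := by
  funext c
  rw [ctwist_apply, avgFun, avgFun, corr_ctwist ℰ hz, axialAvg_ctwist hj hz]
  split_ifs with h
  · rw [← mul_assoc, ← hz, mul_assoc]
  · rw [one_mul]

/-- `Averaging`-level form. [cite: Balaban1987RG1, (2.17) p.269] -/
theorem blockAvg_ctwist (ℰ : LoopAverage G) (hj : j + 1 ≤ P.m + P.K) (hz : ∀ g : G, z * g = g * z) (μ : Fin P.d)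
    (s : ZMod (P.sitesPerDir (j+1))) (U : GaugeField P j G) :
    (blockAvg ℰ : Averaging P j G).avg (U.ctwist z μ (fineSlice P j s)) = ((blockAvg ℰ : Averaging P j G).avg U).ctwist z μ s :=
  avgFun_ctwist ℰ hj hz μ s U

/-! ## 3. All levels: every coarse twist is the image of a fine twist under the iterated averaging -/

/-- **EVERY TWIST OF `T^{(k)}` (`k ≤ m + K`) IS THE `k`-FOLD (0.4)-AVERAGE OF SOME TWIST OF `T^{(0)}`** (downward induction through
`fineSlice`). [cite: Balaban1987RG1, (2.17) p.269] -/
theorem exists_iter_blockAvg_ctwist (ℰ : LoopAverage G) (hz : ∀ g : G, z * g = g * z) (μ : Fin P.d) :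
    ∀ (k : ℕ), k ≤ P.m + P.K → ∀ s : ZMod (P.sitesPerDir k), ∃ s₀ : ZMod (P.sitesPerDir 0), ∀ U : GaugeField P 0 G,
      Averaging.iter (fun j => (blockAvg ℰ : Averaging P j G)) k (U.ctwist z μ s₀) =
        (Averaging.iter (fun j => (blockAvg ℰ : Averaging P j G)) k U).ctwist z μ s
  | 0, _, s => ⟨s, fun _ => rfl⟩
  | k + 1, hk, s => by
    obtain ⟨s₀, h₀⟩ := exists_iter_blockAvg_ctwist ℰ hz μ k (Nat.le_of_succ_le hk) (fineSlice P k s)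
    refine ⟨s₀, fun U => ?_⟩
    show (blockAvg ℰ : Averaging P k G).avg (Averaging.iter (fun j => (blockAvg ℰ : Averaging P j G)) k (U.ctwist z μ s₀)) =
      ((blockAvg ℰ : Averaging P k G).avg (Averaging.iter (fun j => (blockAvg ℰ : Averaging P j G)) k U)).ctwist z μ s
    rw [h₀ U, blockAvg_ctwist ℰ hk hz]

end BlockAveraging

end Literature.MathematicalPhysics.QuantumFieldTheory.Balaban1983to89

end
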